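import Literature.AlgebraicTopology.Homotopy.WeakContractionStep
import Literature.AlgebraicTopology.Homotopy.WhiteheadContractibleLeaves
import Mathlib.Geometry.Manifold.ChartedSpace
import Mathlib.Analysis.InnerProductSpace.PiL2
import Mathlib.Topology.Homotopy.Contractible
import HarnessLib

/-!
# Weakly contractible manifolds are contractible; Whitehead–Hurewicz for manifolds from Hurewicz alone

Topic `Literature/AlgebraicTopology/Homotopy`. The named fact
`Literature.AlgebraicTopology.Homotopy.Manifold.contractibleSpace_of_simplyConnected_of_acyclic`
(`WhiteheadContractible.lean`; Bredon, *Topology and Geometry* (1993), VII Cor. 10.11 with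
Milnor 1959, Cor. 1: a simply connected Hausdorff second countable topological `n`-manifold with
`Hₖ(M; ℤ) = 0` for `k ≥ 1` is contractible) was reduced in `WhiteheadContractibleLeaves.lean` to
three leaves: Hurewicz (`Literature.AlgebraicTopology.SingularHomology.hurewicz_iso`, named
fact), Whitehead's contractibility criterion for CW complexes (discharged there,
`whitehead_contractibleSpace_holds`) and Milnor's theorem that manifolds have the homotopy type
of CW complexes (`Manifold.exists_cwComplex_homotopyEquiv`, named fact; ANR theory, nothing in
Mathlib). This file **removes the Milnor leaf**: it PROVES directly

* `Literature.AlgebraicTopology.Homotopy.Manifold.contractibleSpace_of_subsingleton_homotopyGroup`: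
  a Hausdorff, second countable topological `n`-manifold (`ChartedSpace (EuclideanSpace ℝ (Fin n)) M`)
  which is path connected with `π_k(M, x) = 0` for all `k ≥ 1` and all `x` is contractible
  (classically: Whitehead's theorem, Hatcher 2002 Thm. 4.5, plus the CW homotopy type of
  manifolds, Milnor 1959 Cor. 1 — here by a direct construction);

and deduces

* `Literature.AlgebraicTopology.Homotopy.Manifold.contractibleSpace_of_simplyConnected_of_acyclic_of_hurewicz`:
  the named fact GIVEN ONLY the Hurewicz theorem `hurewicz_iso` (Hatcher 2002, Thm. 4.32;
  Bredon VII Cor. 10.10), via `subsingleton_homotopyGroup_of_isZero_singularHomology` of the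
  Leaves file.

## Proof of the first theorem

Fix `x₀`; all `πₘ(M, x₀)` vanish, so cubes in `M` contract to `x₀`
(`WhiteheadCW.cubesContract_of_subsingleton_homotopyGroup`). Choose countably many charts `e k`
(valued in `ℝⁿ = Fin n → ℝ`, via `EuclideanSpace.equiv`) with compact pieces
`C k ⊆ (e k).source` whose interiors cover `M` (second countability and local compactness,
`nonempty_coverData`). Stage `k` (`CoverData.MStage k`, `CoverData.mstages`) is a partial
null-homotopy `H_k` of the identity, continuous on `W_k × [0, 1]` with `W_k` open containing
`C 0 ∪ … ∪ C (k-1)`, constant `= x₀` from time `τ_k < 1` on; stage `k + 1` is the chart step of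
`WeakContractionStep.lean` applied to `H_k`, the chart `e k` and the piece `C k`, preserving
`C 0 ∪ … ∪ C (k-1)`: so `H_{k+1} = H_k` there (`mstages_H_eq`), the stages stabilise on every
piece, and the limit `CoverData.limH` — at `x`, the homotopy of the first stage after `x`'s
piece — is continuous (it is `H_{j+1}` on the interior of `C j`), starts at the identity and ends
at `x₀` (`CoverData.contractibleSpace`). No CW structure on `M`, no triangulation and no ANR
theory is used.

## References

* A. Hatcher, *Algebraic Topology*, CUP (2002), §4.1, Thm. 4.5, Lemma 4.7; §4.2, Thm. 4.32.
  [HatcherAT2002]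
* J. Milnor, *On spaces having the homotopy type of a CW-complex*, Trans. AMS 90 (1959)
  272–280, Cor. 1. [Milnor1959]
* G. E. Bredon, *Topology and Geometry*, GTM 139 (1993), Ch. VII, Cor. 10.10, Cor. 10.11
  (printed p. 479). [Bredon1993]
-/

noncomputable section

open Set Metric
open scoped Topology

namespace Literature.AlgebraicTopology.Homotopy

namespace Manifold

universe u

namespace WeakContraction

variable {M : Type u} [TopologicalSpace M] [T2Space M] {n : ℕ}

/-! ### Iterating the chart step along a countable cover, and the limit null-homotopy -/

variable (M n) in
/-- The data driving the global construction: a base point at which cubes contract, and a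
sequence of charts `e k` with compact pieces `C k ⊆ (e k).source` whose interiors cover `M`.
[folklore] -/
structure CoverData (x₀ : M) where
  /-- cubes contract to the base point (all homotopy groups vanish) -/
  hX : WhiteheadCW.CubesContract x₀
  /-- the charts -/
  e : ℕ → OpenPartialHomeomorph M (Fin n → ℝ)
  /-- the compact pieces -/
  C : ℕ → Set M
  hC : ∀ k, IsCompact (C k)
  hCe : ∀ k, C k ⊆ (e k).source
  hcov : ∀ x : M, ∃ k, x ∈ interior (C k)

namespace CoverData

variable {x₀ : M} (cd : CoverData M n x₀)

/-- The union of the first `k` pieces. [folklore] -/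
def pieces (k : ℕ) : Set M := ⋃ i ∈ Finset.range k, cd.C i

omit [T2Space M] in
/-- The union of the first `k` pieces is compact. [folklore] -/
theorem isCompact_pieces (k : ℕ) : IsCompact (cd.pieces k) :=
  (Finset.range k).isCompact_biUnion fun i _ => cd.hC i

omit [T2Space M] in
/-- No pieces yet at stage `0`. [folklore] -/
theorem pieces_zero : cd.pieces 0 = ∅ := by simp [pieces]

omit [T2Space M] in
/-- The pieces at stage `k + 1`. [folklore] -/
theorem pieces_succ (k : ℕ) : cd.pieces (k + 1) = cd.C k ∪ cd.pieces k := by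
  ext x
  simp only [pieces, mem_iUnion, Finset.mem_range, mem_union, exists_prop]
  constructor
  · rintro ⟨i, hi, hx⟩
    rcases Nat.lt_succ_iff_lt_or_eq.1 hi with h | rfl
    exacts [Or.inr ⟨i, h, hx⟩, Or.inl hx]
  · rintro (hx | ⟨i, hi, hx⟩)
    exacts [⟨k, lt_add_one k, hx⟩, ⟨i, Nat.lt_succ_of_lt hi, hx⟩]

omit [T2Space M] in
/-- Each of the first `k` pieces lies in their union. [folklore] -/
theorem subset_pieces {i k : ℕ} (h : i < k) : cd.C i ⊆ cd.pieces k :=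
  subset_biUnion_of_mem (u := fun i => cd.C i) (Finset.mem_range.2 h)

/-- Stage `k` of the global construction: a partial null-homotopy of the identity on an open set
containing the first `k` pieces, constant `= x₀` from time `τ < 1` on. [folklore] -/
structure MStage (k : ℕ) where
  /-- the domain -/
  W : Set M
  /-- the homotopy -/
  H : M × ℝ → M
  /-- the lateness time -/
  τ : ℝ
  isOpen_W : IsOpen W
  pieces_subset : cd.pieces k ⊆ W
  τ_pos : 0 < τ
  τ_lt_one : τ < 1
  cont : ContinuousOn H (W ×ˢ Icc (0 : ℝ) 1)
  zero : ∀ x ∈ W, H (x, 0) = x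
  late : ∀ x ∈ W, ∀ t ∈ Icc τ 1, H (x, t) = x₀

/-- Stage `0`: nothing yet. [folklore] -/
def mstageZero : cd.MStage 0 where
  W := ∅
  H p := p.1
  τ := 2⁻¹
  isOpen_W := isOpen_empty
  pieces_subset := by rw [pieces_zero]
  τ_pos := by norm_num
  τ_lt_one := by norm_num
  cont := by rw [empty_prod]; exact continuousOn_empty _
  zero _ h := absurd h (notMem_empty _)
  late _ h := absurd h (notMem_empty _)

variable {cd} {k : ℕ}

namespace MStage

/-- The chart step out of stage `k` (a choice). [folklore] -/
def step (s : cd.MStage k) : StepResult x₀ s.H (cd.pieces k) (cd.C k) ((s.τ + 1) / 2) :=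
  Classical.choice (nonempty_stepResult cd.hX (cd.e k) (cd.hC k) (cd.hCe k) s.isOpen_W
    (cd.isCompact_pieces k) s.pieces_subset s.cont s.zero s.τ_pos (by linarith [s.τ_lt_one])
    (by linarith [s.τ_lt_one]) s.late)

/-- The next stage. [folklore] -/
def next (s : cd.MStage k) : cd.MStage (k + 1) where
  W := s.step.W
  H := s.step.H
  τ := (s.τ + 1) / 2
  isOpen_W := s.step.isOpen_W
  pieces_subset := by rw [pieces_succ, union_comm]; exact s.step.subset_W
  τ_pos := by linarith [s.τ_pos]
  τ_lt_one := by linarith [s.τ_lt_one]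
  cont := s.step.cont
  zero := s.step.zero
  late := s.step.late

/-- The next stage agrees with the current one on the current pieces. [folklore] -/
theorem next_H_eq (s : cd.MStage k) {x : M} (hx : x ∈ cd.pieces k) (t : ℝ) :
    s.next.H (x, t) = s.H (x, t) :=
  s.step.eqOn_V x (s.step.subset_V hx) t

end MStage

variable (cd)

/-- All stages, by recursion. [folklore] -/
def mstages : (k : ℕ) → cd.MStage k
  | 0 => cd.mstageZero
  | k + 1 => (mstages k).next

/-- The recursion step of `mstages`. [folklore] -/
theorem mstages_succ (k : ℕ) : cd.mstages (k + 1) = (cd.mstages k).next := rfl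

/-- Once a piece has been absorbed, the homotopy on it never changes. [folklore] -/
theorem mstages_H_eq {j : ℕ} {x : M} (hx : x ∈ cd.C j) {k : ℕ} (hk : j + 1 ≤ k) (t : ℝ) :
    (cd.mstages k).H (x, t) = (cd.mstages (j + 1)).H (x, t) := by
  induction k, hk using Nat.le_induction with
  | base => rfl
  | succ k hk ih =>
    rw [← ih, mstages_succ]
    exact (cd.mstages k).next_H_eq (cd.subset_pieces (by omega) hx) t

/-- The index of a piece whose interior contains `x`. [folklore] -/
def idx (x : M) : ℕ := (cd.hcov x).choose

omit [T2Space M] in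
/-- `x` lies in the interior of its piece. [folklore] -/
theorem mem_interior_idx (x : M) : x ∈ interior (cd.C (cd.idx x)) := (cd.hcov x).choose_spec

/-- **The limit null-homotopy**: at `x`, the homotopy of the first stage after `x`'s piece.
[folklore] -/
def limH (p : M × ℝ) : M := (cd.mstages (cd.idx p.1 + 1)).H p

/-- On the piece `C j` the limit homotopy is the stage-`(j+1)` homotopy. [folklore] -/
theorem limH_eq {j : ℕ} {x : M} (hx : x ∈ cd.C j) (t : ℝ) :
    cd.limH (x, t) = (cd.mstages (j + 1)).H (x, t) := by
  have h1 := cd.mstages_H_eq hx (le_max_right (cd.idx x + 1) (j + 1)) t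
  have h2 := cd.mstages_H_eq (interior_subset (cd.mem_interior_idx x))
    (le_max_left (cd.idx x + 1) (j + 1)) t
  unfold limH
  rw [← h2, h1]

/-- The limit homotopy is continuous on `M × [0, 1]`. [folklore] -/
theorem continuousOn_limH : ContinuousOn cd.limH (univ ×ˢ Icc (0 : ℝ) 1) := by
  have hU : (⋃ j, interior (cd.C j)) = univ :=
    eq_univ_of_forall fun x => mem_iUnion.2 ⟨cd.idx x, cd.mem_interior_idx x⟩
  rw [← hU]
  refine continuousOn_iUnion_prod (fun j => isOpen_interior) fun j => ?_
  have hsub : interior (cd.C j) ⊆ (cd.mstages (j + 1)).W :=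
    interior_subset.trans ((cd.subset_pieces (lt_add_one j)).trans (cd.mstages (j + 1)).pieces_subset)
  exact ((cd.mstages (j + 1)).cont.mono (prod_mono hsub Subset.rfl)).congr
    fun p hp => cd.limH_eq (interior_subset hp.1) p.2

/-- The limit homotopy starts at the identity. [folklore] -/
theorem limH_zero (x : M) : cd.limH (x, 0) = x := by
  rw [cd.limH_eq (interior_subset (cd.mem_interior_idx x))]
  exact (cd.mstages _).zero x ((cd.mstages _).pieces_subset
    (cd.subset_pieces (lt_add_one _) (interior_subset (cd.mem_interior_idx x))))

/-- The limit homotopy ends at the constant map `x₀`. [folklore] -/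
theorem limH_one (x : M) : cd.limH (x, 1) = x₀ := by
  rw [cd.limH_eq (interior_subset (cd.mem_interior_idx x))]
  exact (cd.mstages _).late x ((cd.mstages _).pieces_subset
    (cd.subset_pieces (lt_add_one _) (interior_subset (cd.mem_interior_idx x)))) 1
    ⟨(cd.mstages _).τ_lt_one.le, le_rfl⟩

include cd in
/-- **The identity of `M` is null-homotopic**: the limit homotopy contracts `M` to `x₀`.
[folklore] -/
theorem contractibleSpace : ContractibleSpace M := by
  rw [contractible_iff_id_nullhomotopic]
  have hc : Continuous fun p : unitInterval × M => cd.limH (p.2, (p.1 : ℝ)) :=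
    cd.continuousOn_limH.comp_continuous (by fun_prop) fun p => ⟨mem_univ _, p.1.2⟩
  exact ⟨x₀, ⟨⟨⟨fun p => cd.limH (p.2, (p.1 : ℝ)), hc⟩, fun x => cd.limH_zero x,
    fun x => cd.limH_one x⟩⟩⟩

end CoverData

/-! ### The cover of a second countable manifold by compact chart pieces -/

omit [T2Space M] in
/-- A Hausdorff second countable topological `n`-manifold, with a base point at which cubes
contract, carries `CoverData`: countably many charts (valued in `ℝⁿ` with the sup norm, via
`EuclideanSpace.equiv`) with compact pieces whose interiors cover `M` (local compactness and
Lindelöf). [folklore] -/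
theorem nonempty_coverData [SecondCountableTopology M] [ChartedSpace (EuclideanSpace ℝ (Fin n)) M]
    {x₀ : M} (hX : WhiteheadCW.CubesContract x₀) : Nonempty (CoverData M n x₀) := by
  haveI := ChartedSpace.locallyCompactSpace (EuclideanSpace ℝ (Fin n)) M
  let toE : EuclideanSpace ℝ (Fin n) ≃ₜ (Fin n → ℝ) := (EuclideanSpace.equiv (Fin n) ℝ).toHomeomorph
  let ch : M → OpenPartialHomeomorph M (Fin n → ℝ) := fun x =>
    (chartAt (EuclideanSpace ℝ (Fin n)) x).transHomeomorph toE
  have hsrc : ∀ x, x ∈ (ch x).source := fun x => by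
    simp only [ch, OpenPartialHomeomorph.transHomeomorph_source]
    exact mem_chart_source _ x
  have hK : ∀ x, ∃ K : Set M, IsCompact K ∧ x ∈ interior K ∧ K ⊆ (ch x).source := fun x =>
    exists_compact_subset (ch x).open_source (hsrc x)
  choose K hKc hKi hKs using hK
  obtain ⟨s, hs, hsU⟩ := TopologicalSpace.countable_cover_nhds (f := fun x => interior (K x))
    fun x => isOpen_interior.mem_nhds (hKi x)
  have hne : s.Nonempty := by
    have hx := hsU.symm ▸ mem_univ x₀
    obtain ⟨y, hy, -⟩ := mem_iUnion₂.1 hx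
    exact ⟨y, hy⟩
  obtain ⟨g, hg⟩ := hs.exists_eq_range hne
  refine ⟨{
    hX := hX
    e := fun k => ch (g k)
    C := fun k => K (g k)
    hC := fun k => hKc _
    hCe := fun k => hKs _
    hcov := fun x => ?_ }⟩
  have hx := hsU.symm ▸ mem_univ x
  obtain ⟨y, hy, hxy⟩ := mem_iUnion₂.1 hx
  rw [hg] at hy
  obtain ⟨k, rfl⟩ := hy
  exact ⟨k, hxy⟩

end WeakContraction

/-! ## The theorems -/

/-- **A weakly contractible manifold is contractible.** If `M` is a Hausdorff, second countable
topological `n`-manifold (`ChartedSpace (EuclideanSpace ℝ (Fin n)) M`) which is path connected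
and all of whose homotopy groups `π_k(M, x)` (`k ≥ 1`, Mathlib's `π_ k M x`) are trivial, then
`M` is contractible. Classically this is Whitehead's theorem (Hatcher 2002, Thm. 4.5) combined
with the CW homotopy type of manifolds (Milnor 1959, Cor. 1); the proof here is direct: a
null-homotopy of the identity is built chart by chart over finer and finer cubical grids,
filling boxes with `WhiteheadCW.exists_box_extension` (Hatcher 2002, Lemma 4.7), the
obstructions lying in the trivial groups `π_k(M, x₀)`. [folklore] -/
theorem contractibleSpace_of_subsingleton_homotopyGroup (n : ℕ) (M : Type u) [TopologicalSpace M]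
    [T2Space M] [SecondCountableTopology M] [ChartedSpace (EuclideanSpace ℝ (Fin n)) M]
    [PathConnectedSpace M] (hπ : ∀ k : ℕ, 1 ≤ k → ∀ x : M, Subsingleton (π_ k M x)) :
    ContractibleSpace M := by
  let x₀ : M := Classical.arbitrary M
  have hX : WhiteheadCW.CubesContract x₀ :=
    WhiteheadCW.cubesContract_of_subsingleton_homotopyGroup x₀ fun k hk => hπ k hk x₀
  obtain ⟨cd⟩ := WeakContraction.nonempty_coverData (n := n) hX
  exact cd.contractibleSpace


/-- **The Whitehead–Hurewicz recognition principle for manifolds, GIVEN only Hurewicz.** The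
named fact `Manifold.contractibleSpace_of_simplyConnected_of_acyclic` of
`WhiteheadContractible.lean` (Bredon 1993, VII Cor. 10.11 with Milnor 1959, Cor. 1: a simply
connected Hausdorff second countable topological `n`-manifold with `Hₖ(M; ℤ) = 0` for all
`k ≥ 1` is contractible) follows from the Hurewicz theorem alone (`hurewicz_iso`, Hatcher 2002,
Thm. 4.32; Bredon VII Cor. 10.10: all homotopy groups of a simply connected acyclic space vanish,
`subsingleton_homotopyGroup_of_isZero_singularHomology`) and the theorem
`Manifold.contractibleSpace_of_subsingleton_homotopyGroup` above — the Whitehead and Milnor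
leaves of `WhiteheadContractibleLeaves.lean` are no longer needed. [cite: Bredon1993, Ch. VII Cor. 10.10 and Cor. 10.11] -/
theorem contractibleSpace_of_simplyConnected_of_acyclic_of_hurewicz
    (h432 : SingularHomology.hurewicz_iso.{u}) :
    Manifold.contractibleSpace_of_simplyConnected_of_acyclic.{u} := by
  intro n M _ _ _ _ _ hac
  exact contractibleSpace_of_subsingleton_homotopyGroup n M
    (subsingleton_homotopyGroup_of_isZero_singularHomology h432 hac)

end Manifold

end Literature.AlgebraicTopology.Homotopy

end
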